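import Summits.AtomisticToContinuum.Crystallization.Theorems.FrustratedLawDichotomyStrainedPatchHomEntryGramHcp

/-!
# (C′) FORCE/EXEMPT PRUNE, kernel kit part 1: interval enclosure of the ONE-ATOM MOVE SLOPE of a lattice term over an entry/shuffle box
# (27623 strained-patch piece, `(H) HomFloor`, hcp half; decomp-a2c hand-2 g27 — critic row 1019 (ask 3): hand-2 = the Boolean `forceOut`)

Critic row 1019 re-books `(H)`-hcp ⟸ an ∃-tree over `entryLeafOKHX := forceOut ∨ entryLeafOKHQ μ`, where `forceOut` certifies `ExemptNear (9/5) ExRec`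
at the centre through `MoveUnstableCore 0 7 s` (a one-atom move of the centre by `s•e`).  By the mean value theorem (hand-1 g26's soundness core
`moveUnstableCore_of_slope`, in flight) it suffices to bound the SLOPE of `τ ↦ Σ_v V_LJ ‖τ•e − v‖` on `τ ∈ [0, s]` by `< −(7/(7−s))⁷·S₇♯(7)`, summed over
the lattice points `v = U(P b)` / `U(P b + t + ξ)` of the ball.  With `V_LJ r = r⁻¹²/12 − r⁻⁶/6` and `Q(τ) = ‖τ•e − v‖²` the slope of ONE term is the
closed form

  `((Q⁻¹)⁴ − (Q⁻¹)⁷) · (τ·⟪e, e⟫ − ⟪v, e⟫)`  (`= V_LJ′(r)·(d r/dτ)`, `r² = Q`; the identification with the derivative is hand-1's lemma, NOT used here).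

This DEFINITIONS-ONLY-PLUS-SOUNDNESS module (design memo HOME/decomp-a2c-hand-2/g27/FORCEOUT-DESIGN-hand-2-g27.md) builds the per-label kernel enclosure of
that closed form from the tree's entry/shuffle interval primitives (`…HomEntryGramHcp.uF / uT / dot3`, Literature `Numerics.FI`) — no tables, no
monotonicity: `(Q⁻¹)⁴(1 − (Q⁻¹)³)`-type expressions are enclosed by plain interval products (`FI.mem_mul` is sign-generic; the box widths `2⁻⁹` make the
dependency overestimation negligible against the ×18 force margin of FINDING A):

* §1 `vecA / vecB` — components of `v = latPt U hexFrame b` (`A` family) and `v = latPt U hexFrame b + U (hcpShift + ξ)` (`B` family) with `mem_vecA / mem_vecB`;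
* §2 `dirFI` (a rational move direction `e = en/ed`), `tauFI` (`τ ∈ [0, s]`, `s = sn/sd`), `relFI` (components of `τ•e − v`), `sqFI` (`Q`), `linFI`
  (`τ⟪e,e⟫ − ⟪v,e⟫`), `phiFI` (`(Q⁻¹)⁴ − (Q⁻¹)⁷` via `FI.divPos`), ★ `slopeFI` (the term), each with its `mem_` lemma; ★★ `mem_slopeFI_A / mem_slopeFI_B`:
  for every `U`, `ξ` in the box `(c, w)` and every `τ ∈ [0, s]` the closed-form slope of the label-`b` term lies in `slopeFI …`;
* §3 a kernel smoke test (`decide +kernel`, < 1 s): identity box `2⁻⁹`, `e = (1,0,0)`, `s = 10⁻³`, label `(2,0,0)` ⇒ enclosure `⊂ (−9·10⁻³, 0)`.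

Successor (hand-2 g28): the label sum over `[−9,9]³`-type boxes with the `‖v‖ ≤ 7` in/out/straddle classification (memo §2–§3), the threshold test, the
direction menu, `forceOut_sound` into the `hver` shape via hand-1's MVT lemma + `…HomPruned.pruneHcp_of_forceOut`'s last three lines.
All definitions computable; 0 sorry; axioms standard; no instances / notation.  `--supports stmt-AtomisticToContinuum-27623`.
-/

namespace Summit.AtomisticToContinuum.Crystallization.Theorems.FrustratedLawDichotomyStrainedPatchHomForceKit

open scoped BigOperators RealInnerProductSpace
open Literature.Analysis.ValidatedNumerics.Numerics
open Summit.AtomisticToContinuum.Crystallization.Theorems.ChargedEnergyGapNegative (E3)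
open Summit.AtomisticToContinuum.Crystallization.Theorems.FrustratedLawDichotomyStrainedPatchHomSplit
open Summit.AtomisticToContinuum.Crystallization.Theorems.FrustratedLawDichotomyStrainedPatchHomLeafCalculus (inner_eq_sum_apply)
open Summit.AtomisticToContinuum.Crystallization.Theorems.FrustratedLawDichotomyStrainedPatchHomEntryGram (entryFI mem_entryFI)
open Summit.AtomisticToContinuum.Crystallization.Theorems.FrustratedLawDichotomyStrainedPatchHomEntryGramHcp
  (uF uT dot3 shufFI mem_uF mem_uT mem_dot3 mem_shufFI)

/-! ## §1. Components of the lattice displacement `v` over the box -/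

/-- `latPt U f b = Σᵢ bᵢ • U fᵢ`. [formal bookkeeping] -/
theorem latPt_eq_sum_smul (U : E3 →L[ℝ] E3) (f : Fin 3 → E3) (b : Fin 3 → ℤ) :
    latPt U f b = ∑ i : Fin 3, ((b i : ℤ) : ℝ) • U (f i) := by
  simp [latPt, map_sum, map_smul]

/-- Component `a` of `latPt U hexFrame b`: `Σᵢ (U fᵢ)ₐ · bᵢ`. [formal bookkeeping] -/
theorem latPt_apply (U : E3 →L[ℝ] E3) (b : Fin 3 → ℤ) (a : Fin 3) :
    (latPt U hexFrame b) a = ∑ i : Fin 3, (U (hexFrame i)) a * ((b i : ℤ) : ℝ) := by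
  rw [latPt_eq_sum_smul]
  simp [Finset.sum_apply, smul_eq_mul, mul_comm]

/-- Kernel components of `v = latPt U hexFrame b` (`A` family) from the entry intervals `E`. -/
def vecA (E : Fin 3 × Fin 3 → FI) (b : Fin 3 → ℤ) (a : Fin 3) : FI :=
  (((uF E 0 a).mulInt (b 0)).add ((uF E 1 a).mulInt (b 1))).add ((uF E 2 a).mulInt (b 2))

/-- Kernel components of `v = latPt U hexFrame b + U (hcpShift + ξ)` (`B` family). -/
def vecB (E : Fin 3 × Fin 3 → FI) (X : Fin 3 → FI) (b : Fin 3 → ℤ) (a : Fin 3) : FI := (vecA E b a).add (uT E X a)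

/-- `vecA` encloses the components of the `A`-family displacement. [folklore] -/
theorem mem_vecA (U : E3 →L[ℝ] E3) {E : Fin 3 × Fin 3 → FI}
    (hE : ∀ ab : Fin 3 × Fin 3, FI.mem ((U (EuclideanSpace.single ab.2 (1 : ℝ))) ab.1) (E ab)) (b : Fin 3 → ℤ) (a : Fin 3) :
    FI.mem ((latPt U hexFrame b) a) (vecA E b a) := by
  rw [latPt_apply, Fin.sum_univ_three]
  exact FI.mem_add (FI.mem_add (FI.mem_mulInt (mem_uF U hE 0 a) _) (FI.mem_mulInt (mem_uF U hE 1 a) _)) (FI.mem_mulInt (mem_uF U hE 2 a) _)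

/-- `vecB` encloses the components of the `B`-family displacement. [folklore] -/
theorem mem_vecB (U : E3 →L[ℝ] E3) (ξ : E3) {E : Fin 3 × Fin 3 → FI} {X : Fin 3 → FI}
    (hE : ∀ ab : Fin 3 × Fin 3, FI.mem ((U (EuclideanSpace.single ab.2 (1 : ℝ))) ab.1) (E ab)) (hX : ∀ i, FI.mem (ξ i) (X i))
    (b : Fin 3 → ℤ) (a : Fin 3) : FI.mem ((latPt U hexFrame b + U (hcpShift + ξ)) a) (vecB E X b a) := by
  rw [PiLp.add_apply]
  exact FI.mem_add (mem_vecA U hE b a) (mem_uT U ξ hE hX a)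

/-! ## §2. The move data, the closed-form slope of one term, and its enclosure -/

/-- The real move direction with rational coordinates `en a / ed`. -/
noncomputable def dirVec (en : Fin 3 → ℤ) (ed : ℕ) : E3 := (EuclideanSpace.equiv (Fin 3) ℝ).symm fun a => (en a : ℝ) / ed

/-- Coordinates of `dirVec`. [formal bookkeeping] -/
theorem dirVec_apply (en : Fin 3 → ℤ) (ed : ℕ) (a : Fin 3) : dirVec en ed a = (en a : ℝ) / ed := rfl

/-- Kernel components of the move direction. -/
def dirFI (en : Fin 3 → ℤ) (ed : ℕ) (a : Fin 3) : FI := FI.ofFrac (en a) ed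

/-- `dirFI` encloses the direction. [formal bookkeeping] -/
theorem mem_dirFI (en : Fin 3 → ℤ) {ed : ℕ} (hed : 0 < ed) (a : Fin 3) : FI.mem (dirVec en ed a) (dirFI en ed a) := by
  rw [dirVec_apply]; exact FI.mem_ofFrac (en a) hed

/-- Kernel interval of the move parameter `τ ∈ [0, s]`, `s = sn / sd`. -/
def tauFI (sn : ℤ) (sd : ℕ) : FI := FI.span (FI.ofInt 0) (FI.ofFrac sn sd)

/-- `tauFI` encloses every `τ ∈ [0, s]`. [formal bookkeeping] -/
theorem mem_tauFI {τ : ℝ} {sn : ℤ} {sd : ℕ} (hsd : 0 < sd) (h0 : 0 ≤ τ) (hs : τ ≤ (sn : ℝ) / sd) : FI.mem τ (tauFI sn sd) :=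
  FI.mem_span (by simpa using FI.mem_ofInt 0) (FI.mem_ofFrac sn hsd) h0 hs

/-- Components of the relative vector `τ•e − v` from component enclosures `V` of `v`. -/
def relFI (en : Fin 3 → ℤ) (ed : ℕ) (sn : ℤ) (sd : ℕ) (V : Fin 3 → FI) (a : Fin 3) : FI :=
  ((tauFI sn sd).mul (dirFI en ed a)).sub (V a)

/-- `relFI` encloses the components of `τ•e − v`. [formal bookkeeping] -/
theorem mem_relFI {en : Fin 3 → ℤ} {ed : ℕ} (hed : 0 < ed) {sn : ℤ} {sd : ℕ} (hsd : 0 < sd) {τ : ℝ} (h0 : 0 ≤ τ) (hs : τ ≤ (sn : ℝ) / sd)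
    {v : E3} {V : Fin 3 → FI} (hv : ∀ a, FI.mem (v a) (V a)) (a : Fin 3) :
    FI.mem ((τ • dirVec en ed - v) a) (relFI en ed sn sd V a) := by
  rw [PiLp.sub_apply, PiLp.smul_apply, smul_eq_mul]
  exact FI.mem_sub (FI.mem_mul (mem_tauFI hsd h0 hs) (mem_dirFI en hed a)) (hv a)

/-- `Q = ‖τ•e − v‖²` in the kernel. -/
def sqFI (en : Fin 3 → ℤ) (ed : ℕ) (sn : ℤ) (sd : ℕ) (V : Fin 3 → FI) : FI := dot3 (relFI en ed sn sd V) (relFI en ed sn sd V)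

/-- `sqFI` encloses `‖τ•e − v‖²`. [folklore] -/
theorem mem_sqFI {en : Fin 3 → ℤ} {ed : ℕ} (hed : 0 < ed) {sn : ℤ} {sd : ℕ} (hsd : 0 < sd) {τ : ℝ} (h0 : 0 ≤ τ) (hs : τ ≤ (sn : ℝ) / sd)
    {v : E3} {V : Fin 3 → FI} (hv : ∀ a, FI.mem (v a) (V a)) :
    FI.mem (‖τ • dirVec en ed - v‖ ^ 2) (sqFI en ed sn sd V) := by
  rw [← real_inner_self_eq_norm_sq]
  exact mem_dot3 (mem_relFI hed hsd h0 hs hv) (mem_relFI hed hsd h0 hs hv)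

/-- `τ·⟪e, e⟫ − ⟪v, e⟫` in the kernel (the `τ`-derivative of `Q/2`). -/
def linFI (en : Fin 3 → ℤ) (ed : ℕ) (sn : ℤ) (sd : ℕ) (V : Fin 3 → FI) : FI :=
  ((tauFI sn sd).mul (dot3 (dirFI en ed) (dirFI en ed))).sub (dot3 V (dirFI en ed))

/-- `linFI` encloses `τ·⟪e, e⟫ − ⟪v, e⟫`. [folklore] -/
theorem mem_linFI {en : Fin 3 → ℤ} {ed : ℕ} (hed : 0 < ed) {sn : ℤ} {sd : ℕ} (hsd : 0 < sd) {τ : ℝ} (h0 : 0 ≤ τ) (hs : τ ≤ (sn : ℝ) / sd)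
    {v : E3} {V : Fin 3 → FI} (hv : ∀ a, FI.mem (v a) (V a)) :
    FI.mem (τ * ⟪dirVec en ed, dirVec en ed⟫ - ⟪v, dirVec en ed⟫) (linFI en ed sn sd V) :=
  FI.mem_sub (FI.mem_mul (mem_tauFI hsd h0 hs) (mem_dot3 (mem_dirFI en hed) (mem_dirFI en hed))) (mem_dot3 hv (mem_dirFI en hed))

/-- `(Q⁻¹)⁴ − (Q⁻¹)⁷ = V_LJ′(r)/r` (`r² = Q`) in the kernel: `u = 1/Q` by `FI.divPos` (fails iff the enclosure of `Q` reaches `0`), then plain products. -/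
def phiFI (Q : FI) : Option FI :=
  match FI.divPos (FI.ofInt 1) Q with
  | none => none
  | some u =>
    let u2 := u.mul u
    let u4 := u2.mul u2
    some (u4.sub ((u4.mul u2).mul u))

/-- `phiFI` encloses `(Q⁻¹)⁴ − (Q⁻¹)⁷`. [folklore] -/
theorem mem_phiFI {q : ℝ} {Q P : FI} (hq : FI.mem q Q) (h : phiFI Q = some P) : FI.mem ((q⁻¹) ^ 4 - (q⁻¹) ^ 7) P := by
  unfold phiFI at h
  cases hdiv : FI.divPos (FI.ofInt 1) Q with
  | none => rw [hdiv] at h; exact absurd h (by simp)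
  | some u =>
    rw [hdiv] at h
    simp only [Option.some.injEq] at h
    subst h
    have hu : FI.mem (q⁻¹) u := by
      have := FI.mem_divPos hdiv (by simpa using FI.mem_ofInt 1) hq
      simpa [one_div] using this
    have hu2 : FI.mem (q⁻¹ ^ 2) (u.mul u) := by rw [pow_two]; exact FI.mem_mul hu hu
    have hu4 : FI.mem (q⁻¹ ^ 4) ((u.mul u).mul (u.mul u)) := by
      rw [show q⁻¹ ^ 4 = q⁻¹ ^ 2 * q⁻¹ ^ 2 by ring]; exact FI.mem_mul hu2 hu2
    have hu7 : FI.mem (q⁻¹ ^ 7) ((((u.mul u).mul (u.mul u)).mul (u.mul u)).mul u) := by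
      rw [show q⁻¹ ^ 7 = q⁻¹ ^ 4 * q⁻¹ ^ 2 * q⁻¹ by ring]; exact FI.mem_mul (FI.mem_mul hu4 hu2) hu
    exact FI.mem_sub hu4 hu7

/-- ★ **The slope of ONE Lennard-Jones term along the move**, closed form `((Q⁻¹)⁴ − (Q⁻¹)⁷)·(τ⟪e,e⟫ − ⟪v,e⟫)`, in the kernel (`none` iff the enclosure of
`Q = ‖τ•e − v‖²` reaches `0`, i.e. the label is too close to the moved atom for this box). -/
def slopeFI (en : Fin 3 → ℤ) (ed : ℕ) (sn : ℤ) (sd : ℕ) (V : Fin 3 → FI) : Option FI :=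
  match phiFI (sqFI en ed sn sd V) with
  | none => none
  | some P => some (P.mul (linFI en ed sn sd V))

/-- ★ `slopeFI` encloses the closed-form slope, for any displacement `v` whose components lie in `V` and every `τ ∈ [0, s]`. [folklore] -/
theorem mem_slopeFI {en : Fin 3 → ℤ} {ed : ℕ} (hed : 0 < ed) {sn : ℤ} {sd : ℕ} (hsd : 0 < sd) {τ : ℝ} (h0 : 0 ≤ τ) (hs : τ ≤ (sn : ℝ) / sd)
    {v : E3} {V : Fin 3 → FI} (hv : ∀ a, FI.mem (v a) (V a)) {S : FI} (h : slopeFI en ed sn sd V = some S) :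
    FI.mem (((‖τ • dirVec en ed - v‖ ^ 2)⁻¹ ^ 4 - (‖τ • dirVec en ed - v‖ ^ 2)⁻¹ ^ 7) *
      (τ * ⟪dirVec en ed, dirVec en ed⟫ - ⟪v, dirVec en ed⟫)) S := by
  unfold slopeFI at h
  cases hphi : phiFI (sqFI en ed sn sd V) with
  | none => rw [hphi] at h; exact absurd h (by simp)
  | some P =>
    rw [hphi] at h
    simp only [Option.some.injEq] at h
    subst h
    exact FI.mem_mul (mem_phiFI (mem_sqFI hed hsd h0 hs hv) hphi) (mem_linFI hed hsd h0 hs hv)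

/-- ★★ **`A`-FAMILY TERM**: for `U` with entries in the box `(c, w)` (entry part) and every `τ ∈ [0, s]`, the closed-form slope of the term of label `b`,
`v = latPt U hexFrame b`, lies in `slopeFI en ed sn sd (vecA (entryFI cU wU) b)`. [folklore] -/
theorem mem_slopeFI_A {c w : Fin 3 × Fin 3 → ℤ} (U : E3 →L[ℝ] E3)
    (hbox : ∀ ab : Fin 3 × Fin 3, |(U (EuclideanSpace.single ab.2 (1 : ℝ))) ab.1 - (c ab : ℝ) / SC| ≤ (w ab : ℝ) / SC)
    {en : Fin 3 → ℤ} {ed : ℕ} (hed : 0 < ed) {sn : ℤ} {sd : ℕ} (hsd : 0 < sd) {τ : ℝ} (h0 : 0 ≤ τ) (hs : τ ≤ (sn : ℝ) / sd)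
    (b : Fin 3 → ℤ) {S : FI} (h : slopeFI en ed sn sd (vecA (entryFI c w) b) = some S) :
    FI.mem (((‖τ • dirVec en ed - latPt U hexFrame b‖ ^ 2)⁻¹ ^ 4 - (‖τ • dirVec en ed - latPt U hexFrame b‖ ^ 2)⁻¹ ^ 7) *
      (τ * ⟪dirVec en ed, dirVec en ed⟫ - ⟪latPt U hexFrame b, dirVec en ed⟫)) S :=
  mem_slopeFI hed hsd h0 hs (mem_vecA U (fun ab => mem_entryFI (hbox ab)) b) h

/-- ★★ **`B`-FAMILY TERM**: the same for `v = latPt U hexFrame b + U (hcpShift + ξ)` with the shuffle `ξ` in the box `(c, w)` (twelve coordinates, the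
`…HomEntryGramHcp` convention `Sum.inl` = entries, `Sum.inr` = shuffle). [folklore] -/
theorem mem_slopeFI_B {c w : (Fin 3 × Fin 3) ⊕ Fin 3 → ℤ} (U : E3 →L[ℝ] E3) (ξ : E3)
    (hbox : ∀ ab : Fin 3 × Fin 3, |(U (EuclideanSpace.single ab.2 (1 : ℝ))) ab.1 - (c (Sum.inl ab) : ℝ) / SC| ≤ (w (Sum.inl ab) : ℝ) / SC)
    (hξ : ∀ i : Fin 3, |ξ i - (c (Sum.inr i) : ℝ) / SC| ≤ (w (Sum.inr i) : ℝ) / SC)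
    {en : Fin 3 → ℤ} {ed : ℕ} (hed : 0 < ed) {sn : ℤ} {sd : ℕ} (hsd : 0 < sd) {τ : ℝ} (h0 : 0 ≤ τ) (hs : τ ≤ (sn : ℝ) / sd)
    (b : Fin 3 → ℤ) {S : FI}
    (h : slopeFI en ed sn sd (vecB (entryFI (fun ab => c (Sum.inl ab)) (fun ab => w (Sum.inl ab))) (shufFI c w) b) = some S) :
    FI.mem (((‖τ • dirVec en ed - (latPt U hexFrame b + U (hcpShift + ξ))‖ ^ 2)⁻¹ ^ 4 -
        (‖τ • dirVec en ed - (latPt U hexFrame b + U (hcpShift + ξ))‖ ^ 2)⁻¹ ^ 7) *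
      (τ * ⟪dirVec en ed, dirVec en ed⟫ - ⟪latPt U hexFrame b + U (hcpShift + ξ), dirVec en ed⟫)) S :=
  mem_slopeFI hed hsd h0 hs (mem_vecB U ξ (fun ab => mem_entryFI (hbox ab)) (fun i => mem_shufFI (hξ i)) b) h

/-- The `A` family with the twelve-coordinate box convention (entries under `Sum.inl`), for uniformity with `mem_slopeFI_B`. [folklore] -/
theorem mem_slopeFI_A' {c w : (Fin 3 × Fin 3) ⊕ Fin 3 → ℤ} (U : E3 →L[ℝ] E3)
    (hbox : ∀ ab : Fin 3 × Fin 3, |(U (EuclideanSpace.single ab.2 (1 : ℝ))) ab.1 - (c (Sum.inl ab) : ℝ) / SC| ≤ (w (Sum.inl ab) : ℝ) / SC)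
    {en : Fin 3 → ℤ} {ed : ℕ} (hed : 0 < ed) {sn : ℤ} {sd : ℕ} (hsd : 0 < sd) {τ : ℝ} (h0 : 0 ≤ τ) (hs : τ ≤ (sn : ℝ) / sd)
    (b : Fin 3 → ℤ) {S : FI}
    (h : slopeFI en ed sn sd (vecA (entryFI (fun ab => c (Sum.inl ab)) (fun ab => w (Sum.inl ab))) b) = some S) :
    FI.mem (((‖τ • dirVec en ed - latPt U hexFrame b‖ ^ 2)⁻¹ ^ 4 - (‖τ • dirVec en ed - latPt U hexFrame b‖ ^ 2)⁻¹ ^ 7) *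
      (τ * ⟪dirVec en ed, dirVec en ed⟫ - ⟪latPt U hexFrame b, dirVec en ed⟫)) S :=
  mem_slopeFI hed hsd h0 hs (mem_vecA U (fun ab => mem_entryFI (hbox ab)) b) h

/-! ## §3. Kernel smoke test -/

/-- Identity entry box centre (scaled). -/
def cId : Fin 3 × Fin 3 → ℤ := fun ab => if ab.1 = ab.2 then (SC : ℤ) else 0
/-- Entry half-width `2⁻⁹` (scaled `2^39`). -/
def w9 : Fin 3 × Fin 3 → ℤ := fun _ => 549755813888

/-- SMOKE TEST (kernel): at the identity box of half-width `2⁻⁹`, direction `e = (1,0,0)`, step `s = 10⁻³`, the `A`-label `b = (2,0,0)` (`v = 2e₀`,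
`Q ≈ 4`, slope `≈ (4⁻⁴ − 4⁻⁷)·(τ − 2) ≈ −7.7·10⁻³`) gets an enclosure with `hi < 0` and `lo > −9·10⁻³`. [formal bookkeeping] -/
theorem slopeFI_smoke :
    (match slopeFI ![1, 0, 0] 1 1 1000 (vecA (entryFI cId w9) ![2, 0, 0]) with
      | none => false
      | some S => decide (S.hi < 0) && decide (-9 * (SC : ℤ) < S.lo * 1000)) = true := by
  decide +kernel

end Summit.AtomisticToContinuum.Crystallization.Theorems.FrustratedLawDichotomyStrainedPatchHomForceKit
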